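import Mathlib.GroupTheory.IsPerfect
import Mathlib.LinearAlgebra.Matrix.SpecialLinearGroup
import Literature.NumberTheory.Automorphic.RootSpaceLine
import Literature.NumberTheory.Automorphic.LieCentralizerTorusHolds
import Literature.NumberTheory.Automorphic.BorelConjugacy
import Literature.NumberTheory.Automorphic.BorelParabolic
import Literature.NumberTheory.Automorphic.RankOneAssembly
import HarnessLib

/-!
# `dim B = dim T + ½|R|` for Borel subgroups `B ⊇ T` (Springer 8.1.3 (ii)), characteristic `0`
(trunk T-AUTOMORPHIC, G25 AutomorphicL; towards the named fact
`Literature.NumberTheory.Automorphic.zdim_borel_and_group` of `ReductiveDualChevalleyBasedProofs.lean`)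

The named fact `zdim_borel_and_group` vendors Springer, *Linear Algebraic Groups* (2nd ed.),
Cor. 8.1.3 (ii): *"Let `B` be a Borel subgroup of `G` containing `T` … (ii) `dim B = r + ½|R|`,
`dim G = r + |R|`, where `r = dim T`"* (`G` connected reductive over an algebraically closed field
of any characteristic, `T` a maximal torus; printed proof: *"Using 8.1.2 one determines `dim 𝔟`
and `dim 𝔤`"*). In positive characteristic 8.1.2 (`P = R`, `dim 𝔤_α = 1`: the tree's named fact
`lieWeights_eq_roots`) and the positive system `R⁺(B)` (7.4.5, through 6.4.7 (ii) and 7.3.3 (ii):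
the named facts `isBorelIn_centralizer_inf_of_isBorelIn`, `exists_rootHom_sup_isBorelIn_of_central`)
are open leaves of the structure theory in this vocabulary. This file proves the statement **over
algebraically closed fields of characteristic `0`, granted a root datum of `(G, T)`**
(`IsRootDatumOf`, Springer 7.4.3 — the named fact `exists_isRootDatumOf` of `ReductiveDual.lean`),
by a Lie-algebra argument replacing `R⁺(B)`:

* `dim Lie(H) = dim T + #{α ∈ R | Lie(H)_α ≠ 0}` for every `T ≤ H ≤ G`
  (`IsRootDatumOf.finrank_lieAlgebraGL_eq`): `Lie(H) = Lie(H)^T ⊕ ⨁ Lie(H)_α` (7.1.1), the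
  non-zero weights are roots (`lieWeights_subset_roots`, characteristic `0`), `𝔤^T = L(T)`
  (`lieWeightSpace_one_le_lieAlgebraGL_holds`, 5.4.7 with 7.6.4 (ii) in characteristic `0`) and
  `dim 𝔤_α = 1` (`finrank_lieWeightSpace_le_one_of_lieWeightSpace_one_le`, 8.1.2);
* **at most one of `𝔤_{±α}` lies in `Lie(B)`** for a closed solvable `B ≤ G`
  (`IsRootDatumOf.not_lieWeightSpace_ne_bot_and_neg`): otherwise the root homomorphisms
  `u_{±α}(x) = exp (x e_{±α})` of the `SL₂` of the root datum take values in `B`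
  (`expHom_mem_of_mem_lieAlgebraGL`), so `φ_α(SL₂) ≤ B` (`SL₂` is generated by its unipotents,
  Mathlib `SL2.transvection_induction`) and `SL₂(k)` would be solvable (its proper normal
  subgroups are central, `SL2_normal_le_center`), contradicting `(SL₂, SL₂) = SL₂` (Mathlib
  `SL2.commutator_eq_top`); hence `dim B ≤ dim T + ½|R|` for every Borel subgroup `B ⊇ T`;
* for a regular coweight `y`, `H(y) = ⟨T, U_α : ⟨α, y⟩ > 0⟩` is closed connected (2.2.7 (i)) and
  solvable (`isSolvable_sup_iSup_rootSubgroup_of_coweight`, the weight filtration of `kⁿ` as in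
  `WeightFiltrationSolvable.lean`), hence lies in a Borel subgroup `B₁ ⊇ T` with
  `dim B₁ ≥ dim H(y) ≥ dim T + ½|R|`; all Borel subgroups being conjugate (6.2.7 (iii),
  `isBorelIn_conj_holds`) of the same dimension (`IsZConnected.zdim_map_conj`, via 4.4.6),
  **`2 dim B = 2 dim T + |R|`** (`IsRootDatumOf.two_mul_zdim_borel`);
* with `dim G = dim T + |R|` (`zdim_eq_rank_add_card_roots_of_lieWeightSpace_one_le`,
  `RootSpaceLine.lean`): `IsRootDatumOf.zdim_borel_and_group` and the characteristic-`0` discharge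
  of the named fact from 7.4.3, `zdim_borel_and_group_of_exists_isRootDatumOf`.

Not here: positive characteristic (blocked on the named facts above) and the existence of the root
datum (`exists_isRootDatumOf_of_structureFacts`, `RankOneAssembly.lean`).

## References

* [SpringerLAG1998] T. A. Springer, *Linear Algebraic Groups*, 2nd ed., Progress in Mathematics 9,
  Birkhäuser (1998): 2.2.7 (i), 4.4.6, 6.2.7 (iii), 7.1.1, 7.4.3, 7.4.5, Cor. 8.1.2,
  Cor. 8.1.3 (ii) (p. 133), Prop. 8.2.4 (i).
-/

noncomputable section

open scoped MatrixGroups IsMulCommutative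

namespace Literature.NumberTheory.Automorphic

variable {k : Type*} [Field k] {n : Type*} [Fintype n] [DecidableEq n]

/-! ### `SL₂`: generation by unipotents, non-solvability -/

section SL2

/-- A subgroup of `SL(2, k)` containing the upper and the lower unipotent one-parameter subgroups
is everything (`SL₂` over a field is generated by the elementary transvections; Mathlib
`Matrix.SL2.transvection_induction`). [folklore] -/
theorem SL2_eq_top_of_unipotents_mem (N : Subgroup SL(2, k))
    (hU : ∀ x, unipotentUpperSL2 x ∈ N) (hL : ∀ x, unipotentLowerSL2 x ∈ N) : N = ⊤ := by
  refine eq_top_iff.2 fun g _ => ?_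
  refine Matrix.SL2.transvection_induction (fun g => g ∈ N) ?_
    (fun _ _ => N.mul_mem) g
  intro i j hij c
  have key : Matrix.SpecialLinearGroup.transvection hij c = unipotentUpperSL2 (Multiplicative.ofAdd c)
      ∨ Matrix.SpecialLinearGroup.transvection hij c = unipotentLowerSL2 (Multiplicative.ofAdd c) := by
    fin_cases i <;> fin_cases j
    · exact absurd rfl hij
    · left
      apply Subtype.ext
      rw [Matrix.SpecialLinearGroup.transvection_coe, coe_unipotentUpperSL2, toAdd_ofAdd]
      ext a b
      fin_cases a <;> fin_cases b <;> simp
    · right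
      apply Subtype.ext
      rw [Matrix.SpecialLinearGroup.transvection_coe, coe_unipotentLowerSL2, toAdd_ofAdd]
      ext a b
      fin_cases a <;> fin_cases b <;> simp
    · exact absurd rfl hij
  rcases key with h | h <;> rw [h]
  exacts [hU _, hL _]

/-- `SL(2, k)` is not solvable over an infinite field: it is perfect (Mathlib
`Matrix.SL2.commutator_eq_top`, for `a ≠ 0` with `a² ≠ 1`) and non-trivial.
[folklore] -/
theorem not_isSolvable_SL2 [Infinite k] : ¬ IsSolvable SL(2, k) := by
  obtain ⟨a, ha0, ha1⟩ := exists_ne_zero_and_sq_ne_one (k := k)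
  haveI : Group.IsPerfect SL(2, k) :=
    ⟨Matrix.SL2.commutator_eq_top ha0 ha1⟩
  haveI : Nontrivial SL(2, k) := by
    refine ⟨⟨unipotentUpperSL2 (Multiplicative.ofAdd (1 : k)), 1, fun h => ?_⟩⟩
    have h' := congrArg (fun g : SL(2, k) => (g : Matrix (Fin 2) (Fin 2) k) 0 1) h
    simp at h'
  exact Group.IsPerfect.not_isSolvable SL(2, k)

variable {G : Subgroup (GL n k)}

/-- **An algebraic `SL₂ → G` whose unipotents land in a solvable subgroup `B` is impossible**
(when it is injective on the upper unipotents): `SL₂` is generated by its unipotents, so `φ(SL₂) ≤ B`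
is solvable, and `ker φ` — a normal subgroup avoiding the upper unipotents — is central
(`SL2_normal_le_center`), whence `SL₂(k)` would be solvable. [folklore] -/
theorem false_of_sl2Hom_unipotents_mem [Infinite k] {φ : SL(2, k) →* ↥G}
    (hinj : Function.Injective (φ.comp unipotentUpperSL2)) {B : Subgroup (GL n k)}
    (hBs : IsSolvable ↥B) (hU : ∀ x, ((φ (unipotentUpperSL2 x) : ↥G) : GL n k) ∈ B)
    (hL : ∀ x, ((φ (unipotentLowerSL2 x) : ↥G) : GL n k) ∈ B) : False := by
  have hall : ∀ g : SL(2, k), ((φ g : ↥G) : GL n k) ∈ B := by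
    have htop := SL2_eq_top_of_unipotents_mem (B.comap (G.subtype.comp φ)) (fun x => hU x)
      (fun x => hL x)
    intro g
    have hg : g ∈ B.comap (G.subtype.comp φ) := by rw [htop]; exact Subgroup.mem_top g
    exact hg
  set ψ : SL(2, k) →* ↥B := (G.subtype.comp φ).codRestrict B hall with hψ
  have hker : ψ.ker ≤ Subgroup.center SL(2, k) := by
    refine SL2_normal_le_center ψ.ker fun x hx => ?_
    rw [MonoidHom.mem_ker] at hx
    have h1 : φ (unipotentUpperSL2 (Multiplicative.ofAdd x)) = 1 := by
      apply Subtype.ext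
      have := congrArg Subtype.val hx
      simpa [hψ, MonoidHom.codRestrict_apply] using this
    have h2 : (φ.comp unipotentUpperSL2) (Multiplicative.ofAdd x) =
        (φ.comp unipotentUpperSL2) (Multiplicative.ofAdd 0) := by
      rw [MonoidHom.comp_apply, h1, ofAdd_zero, map_one]
    exact Multiplicative.ofAdd.injective (hinj h2)
  haveI : IsSolvable ↥B := hBs
  haveI : IsSolvable ↥(Subgroup.center SL(2, k)) :=
    isSolvable_of_comm fun a b => Subtype.ext (Subgroup.mem_center_iff.1 b.2 a)
  have hsolv : IsSolvable SL(2, k) :=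
    solvable_of_ker_le_range (Subgroup.center SL(2, k)).subtype ψ (by rwa [Subgroup.range_subtype])
  exact not_isSolvable_SL2 hsolv

/-- An injective homomorphism `𝔾ₐ → G` is not trivial. [folklore] -/
lemma ne_one_of_injective {u : Multiplicative k →* ↥G} (hu : Function.Injective u) : u ≠ 1 := by
  intro h1
  subst h1
  exact one_ne_zero (Multiplicative.ofAdd.injective
    (@hu (Multiplicative.ofAdd (1 : k)) (Multiplicative.ofAdd 0) rfl))

end SL2

/-! ### Dimension of conjugates, via the Lie algebra -/

section Conj

/-- `dim Lie(H) ≤ dim Lie(g H g⁻¹)`: `Ad(g)` maps `Lie(H)` injectively into `Lie(g H g⁻¹)`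
(`conj_mem_lieAlgebraGL_map_conj`, Springer 4.4.5 (ii)). [folklore] -/
theorem finrank_lieAlgebraGL_le_map_conj (H : Subgroup (GL n k)) (g : GL n k) :
    Module.finrank k ↥(lieAlgebraGL H) ≤
      Module.finrank k ↥(lieAlgebraGL (H.map (MulAut.conj g : GL n k →* GL n k))) := by
  have hinv : ∀ A : Matrix n n k, adGL g⁻¹ (adGL g A) = A := fun A => by
    rw [← Module.End.mul_apply, ← adGL_mul, inv_mul_cancel, adGL_apply]
    simp
  have hinj : Function.Injective (adGL g) := Function.LeftInverse.injective hinv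
  have hle : (lieAlgebraGL H).map (adGL g) ≤
      lieAlgebraGL (H.map (MulAut.conj g : GL n k →* GL n k)) := by
    rintro _ ⟨A, hA, rfl⟩
    rw [adGL_apply]
    exact conj_mem_lieAlgebraGL_map_conj g hA
  calc Module.finrank k ↥(lieAlgebraGL H)
      = Module.finrank k ↥((lieAlgebraGL H).map (adGL g)) :=
        LinearEquiv.finrank_eq (Submodule.equivMapOfInjective _ hinj _)
    _ ≤ _ := Submodule.finrank_mono hle

variable {H : Subgroup (GL n k)}

/-- **Conjugate connected algebraic subgroups have the same dimension** (inner automorphisms are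
isomorphisms of varieties; here through `dim Lie = dim`, Springer 4.4.6, over a perfect field).
[folklore] -/
theorem IsZConnected.zdim_map_conj [PerfectField k] (hH : IsZConnected H) (g : GL n k) :
    (hH.map_conj g).zdim = hH.zdim := by
  have h1 := hH.finrank_lieAlgebraGL_eq
  have h2 := (hH.map_conj g).finrank_lieAlgebraGL_eq
  have hle1 := finrank_lieAlgebraGL_le_map_conj H g
  have hle2 := finrank_lieAlgebraGL_le_map_conj (H.map (MulAut.conj g : GL n k →* GL n k)) g⁻¹
  rw [map_conj_inv_map_conj] at hle2
  omega

end Conj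

/-! ### A root-pairing count: half the roots are positive on a regular coweight -/

/-- For a regular coweight `y` (no root vanishes on `y`), exactly half of the roots are
`y`-positive: `α ↦ -α` exchanges `y`-positive and `y`-negative roots (Springer 7.4.5 (b)).
[folklore] -/
theorem _root_.RootPairing.two_mul_card_root'_pos {ι X Y : Type*} [AddCommGroup X]
    [AddCommGroup Y] [Finite ι] (P : RootPairing ι ℤ X Y) {y : Y} (hy : ∀ i, P.root' i y ≠ 0) :
    2 * Nat.card {i : ι // 0 < P.root' i y} = Nat.card ι := by
  classical
  letI := P.indexNeg
  have hneg : ∀ i : ι, P.root' (-i) y = -P.root' i y := fun i => by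
    change P.toLinearMap (P.root (P.reflectionPerm i i)) y = -(P.toLinearMap (P.root i) y)
    rw [RootPairing.root_reflectionPerm, RootPairing.reflection_apply_self, map_neg,
      LinearMap.neg_apply]
  let e : {i : ι // 0 < P.root' i y} ≃ {i : ι // ¬ 0 < P.root' i y} :=
    { toFun := fun x => ⟨-x.1, by rw [hneg]; have := x.2; omega⟩
      invFun := fun x => ⟨-x.1, by rw [hneg]; have := x.2; have := hy x.1; omega⟩
      left_inv := fun x => Subtype.ext (neg_neg x.1)
      right_inv := fun x => Subtype.ext (neg_neg x.1) }
  have hsum : Nat.card ι =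
      Nat.card {i : ι // 0 < P.root' i y} + Nat.card {i : ι // ¬ 0 < P.root' i y} := by
    rw [← Nat.card_sum, Nat.card_congr (Equiv.sumCompl fun i => 0 < P.root' i y)]
  rw [hsum, ← Nat.card_congr e]
  ring

/-! ### `⟨T, U_α : ⟨α, y⟩ > 0⟩` is solvable (weight filtration) -/

section Solvable

variable {ι X Y : Type*} [AddCommGroup X] [AddCommGroup Y] {G T : Subgroup (GL n k)}

/-- **`⟨T, U_α : ⟨α, y⟩ > 0⟩` is solvable** for a commutative `T ≤ GL_n` of semisimple elements over
an algebraically closed field, any root pairing `P`, any coweight `y` and any `eX : X*(T) ≃ X` — the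
solvability clause of Springer 8.2.4 (i) for the positive system `R⁺(y)` (7.4.5). Proof by the
weight filtration of `kⁿ`, exactly as `isSolvable_sup_iSup_rootSubgroup_of_isSemisimple`
(`WeightFiltrationSolvable.lean`) with the weights ranked by the strict order
`χ ≺ χ' ⇔ ⟨χ' - χ, y⟩ > 0`. [cite: SpringerLAG1998, Prop 8.2.4 (i) with 7.4.5] -/
theorem isSolvable_sup_iSup_rootSubgroup_of_coweight [IsAlgClosed k] [IsMulCommutative ↥T]
    (hs : ∀ t ∈ T, IsSemisimpleElt t) (P : RootPairing ι ℤ X Y) (y : Y)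
    (eX : Additive ↥(characterLattice T) ≃+ X) :
    IsSolvable ↥(T ⊔ ⨆ (i : ι) (_ : 0 < P.root' i y),
      rootSubgroup G T (charOfWeight eX (P.root i))) := by
  let W : Weights T → Submodule k (n → k) := fun c => charWeightSpace T c.1
  let e : Weights T → X := fun c => eX (Additive.ofMul c.1)
  let lt : Weights T → Weights T → Prop := fun c c' => 0 < P.toLinearMap (e c' - e c) y
  let r : Weights T → ℕ := rankOf lt
  have htrans : ∀ a b c, lt a b → lt b c → lt a c := by
    intro a b c hab hbc
    change 0 < P.toLinearMap (e c - e a) y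
    have hsplit : e c - e a = (e c - e b) + (e b - e a) := by abel
    rw [hsplit, map_add, LinearMap.add_apply]
    exact add_pos hbc hab
  have hirr : ∀ a, ¬ lt a a := by
    intro a ha
    change 0 < P.toLinearMap (e a - e a) y at ha
    rw [sub_self, map_zero, LinearMap.zero_apply] at ha
    exact lt_irrefl _ ha
  refine isSolvable_of_le_levelGroup (W := W) (r := r) (B := Fintype.card (Weights T) + 1)
    (rankOf_lt lt) (iSup_charWeightSpace_eq_top hs) ?_
  refine sup_le (le_levelGroup_weights r) (iSup₂_le fun i hi => ?_)
  have hα : ∀ (c : Weights T) (j : ℕ), 1 ≤ j →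
      charWeightSpace T (c.1 * (Additive.toMul (eX.symm (P.root i))) ^ j) ≤
        stepFiltration W r 1 c := by
    intro c j hj
    by_cases h0 : charWeightSpace T (c.1 * (Additive.toMul (eX.symm (P.root i))) ^ j) = ⊥
    · rw [h0]
      exact bot_le
    · let c' : Weights T := ⟨c.1 * (Additive.toMul (eX.symm (P.root i))) ^ j, h0⟩
      have hstep : lt c c' := by
        have he : e c' = e c + j • P.root i := by
          simp only [e, c', ofMul_mul, ofMul_pow, ofMul_toMul, map_add, map_nsmul,
            AddEquiv.apply_symm_apply]
        change 0 < P.toLinearMap (e c' - e c) y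
        rw [he, add_sub_cancel_left, map_nsmul, LinearMap.smul_apply]
        exact nsmul_pos hi (by omega)
      have hr : r c + 1 ≤ r c' := rankOf_lt_rankOf (lt := lt) htrans hirr hstep
      exact le_stepFiltration (W := W) (r := r) (m := 1) (c := c) (c' := c') hr
  exact rootSubgroup_le_levelGroup (α := Additive.toMul (eX.symm (P.root i))) hα

end Solvable

/-! ### Counting root spaces in `Lie(H)` for `T ≤ H ≤ G` -/

section Count

variable {ι X Y : Type*} [AddCommGroup X] [AddCommGroup Y]
variable {G T : Subgroup (GL n k)} [IsMulCommutative ↥T]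
variable {P : RootPairing ι ℤ X Y} {eX : Additive ↥(characterLattice T) ≃+ X}
  {eY : Additive ↥(cocharacterLattice T) ≃+ Y}

omit [IsMulCommutative ↥T] in
/-- The non-zero weights of `T` in `Lie(H)` are among those in `Lie(G)` for `H ≤ G`
(`Lie(H) ⊆ Lie(G)`, Springer 4.4.7). [folklore] -/
lemma lieWeights_mono {H : Subgroup (GL n k)} (hHG : H ≤ G) : lieWeights H T ⊆ lieWeights G T :=
  fun _ hχ => ⟨hχ.1, fun hb => hχ.2 ((Submodule.eq_bot_iff _).2 fun A hA =>
    (Submodule.eq_bot_iff _).1 hb A ⟨lieAlgebraGL_mono hHG hA.1, hA.2⟩)⟩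

/-- **`dim Lie(H) = dim T + #{α ∈ R | Lie(H)_α ≠ 0}`** for `T ≤ H ≤ G`, `G` connected reductive
over an algebraically closed field of characteristic `0`, `T` a maximal torus with root datum `P`:
`Lie(H)` is the direct sum of `Lie(H)^T = L(T)` (5.4.7 with 7.6.4 (ii),
`lieWeightSpace_one_le_lieAlgebraGL_holds`) and the `Lie(H)_{α_i} ⊆ 𝔤_{α_i}` (7.1.1; the
non-zero weights are roots, 8.1.2, `lieWeights_subset_roots`), and each `𝔤_{α_i}` is a line
(8.1.2, `finrank_lieWeightSpace_le_one_of_lieWeightSpace_one_le`).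
[cite: SpringerLAG1998, Cor. 8.1.2 and 7.1.1] -/
theorem IsRootDatumOf.finrank_lieAlgebraGL_eq [IsAlgClosed k] [CharZero k]
    (hG : IsConnectedReductive G) (hT : IsMaximalTorusIn T G) (h : IsRootDatumOf G T P eX eY)
    {H : Subgroup (GL n k)} (hTH : T ≤ H) (hHG : H ≤ G) :
    Module.finrank k ↥(lieAlgebraGL H) = hT.2.1.1.zdim +
      Nat.card {i : ι // lieWeightSpace H T (charOfWeight eX (P.root i)) ≠ ⊥} := by
  classical
  haveI : Finite ι := h.finite_index hG hT
  letI : Fintype ι := Fintype.ofFinite ι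
  have hTt : IsTorusSubgroup T := hT.2.1
  have h0 : lieWeightSpace G T 1 ≤ lieAlgebraGL T := lieWeightSpace_one_le_lieAlgebraGL_holds G T hG hT
  have hmono : ∀ χ : ↥T →* kˣ, lieWeightSpace H T χ ≤ lieWeightSpace G T χ :=
    fun χ A hA => ⟨lieAlgebraGL_mono hHG hA.1, hA.2⟩
  -- the family `Lie(H)^T, Lie(H)_{α_i}` and its weights
  let Nf : Option ι → Submodule k (Matrix n n k) := fun j =>
    j.elim (lieWeightSpace H T 1) fun i => lieWeightSpace H T (charOfWeight eX (P.root i))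
  let wt : Option ι → (↥T → k) := fun j =>
    j.elim (fun _ => (1 : k)) fun i t => ((charOfWeight eX (P.root i) t : kˣ) : k)
  have hNle : ∀ j, Nf j ≤ adWeightSpace T (wt j) := by
    rintro (_ | i)
    · change lieWeightSpace H T 1 ≤ adWeightSpace T fun _ => (1 : k)
      refine inf_le_right.trans ?_
      rw [weightSpaceGL_eq_adWeightSpace]
      simp
    · change lieWeightSpace H T (charOfWeight eX (P.root i)) ≤
        adWeightSpace T fun t => ((charOfWeight eX (P.root i) t : kˣ) : k)
      rw [← weightSpaceGL_eq_adWeightSpace]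
      exact inf_le_right
  have hwt : Function.Injective wt := by
    have hfun : ∀ i, (fun t : ↥T => ((charOfWeight eX (P.root i) t : kˣ) : k)) ≠ fun _ => 1 := by
      intro i hEq
      obtain ⟨α, hα, hαi⟩ := h.exists_root_eq i
      refine hα.1 (MonoidHom.ext fun t => Units.ext ?_)
      have := congrFun hEq t
      rw [← hαi] at this
      simpa using this
    rintro (_ | i) (_ | j) hij
    · rfl
    · exact absurd hij.symm (hfun j)
    · exact absurd hij (hfun i)
    · have hc : charOfWeight eX (P.root i) = charOfWeight eX (P.root j) :=
        MonoidHom.ext fun t => Units.ext (congrFun hij t)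
      rw [P.root.injective (charOfWeight_injective eX hc)]
  have hind : iSupIndep Nf := ((iSupIndep_adWeightSpace T hTt.2.2).comp hwt).mono fun j => hNle j
  -- the sum is `Lie(H)`
  have hsup : (⨆ j ∈ (Finset.univ : Finset (Option ι)), Nf j) = lieAlgebraGL H := by
    refine le_antisymm (iSup₂_le fun j _ => ?_) ?_
    · rcases j with _ | i
      · exact inf_le_left
      · exact inf_le_left
    · refine (lieAlgebraGL_eq_sup_iSup_lieWeights T hTH hTt.2.2).le.trans (sup_le ?_ ?_)
      · exact le_iSup₂_of_le none (Finset.mem_univ _) le_rfl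
      · refine iSup₂_le fun α hαP => ?_
        have hαR : α ∈ roots G T :=
          lieWeights_subset_roots hG.1.1 hTt.1 hT.1 (lieWeights_mono hHG hαP)
        have hmem : eX (Additive.ofMul α) ∈ Set.range P.root := by
          rw [h.range_root]; exact ⟨α, hαR, rfl⟩
        obtain ⟨i, hi⟩ := hmem
        have hαi : charOfWeight eX (P.root i) = (α : ↥T →* kˣ) := by
          simp [charOfWeight, hi]
        refine le_iSup₂_of_le (some i) (Finset.mem_univ _) ?_
        change lieWeightSpace H T (α : ↥T →* kˣ) ≤ lieWeightSpace H T (charOfWeight eX (P.root i))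
        rw [hαi]
  -- dimensions of the pieces
  have hfinT := hTt.1.finrank_lieAlgebraGL_eq
  have h1 : Nf none = lieAlgebraGL T :=
    le_antisymm ((hmono 1).trans h0) (lieAlgebraGL_le_lieWeightSpace_one hTH)
  have hU : ∀ i, Module.finrank k ↥(Nf (some i)) =
      if lieWeightSpace H T (charOfWeight eX (P.root i)) ≠ ⊥ then 1 else 0 := by
    intro i
    change Module.finrank k ↥(lieWeightSpace H T (charOfWeight eX (P.root i))) = _
    split_ifs with hb
    · refine le_antisymm ((Submodule.finrank_mono (hmono _)).trans
        (finrank_lieWeightSpace_le_one_of_lieWeightSpace_one_le hG hT h0 h i)) ?_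
      rw [Nat.one_le_iff_ne_zero, Ne, Submodule.finrank_eq_zero]
      exact hb
    · rw [not_ne_iff] at hb
      rw [hb, finrank_bot]
  calc Module.finrank k ↥(lieAlgebraGL H)
      = Module.finrank k ↥(⨆ j ∈ (Finset.univ : Finset (Option ι)), Nf j) := by rw [hsup]
    _ = ∑ j ∈ (Finset.univ : Finset (Option ι)), Module.finrank k ↥(Nf j) :=
        finrank_biSup_eq_sum_of_iSupIndep' hind _
    _ = Module.finrank k ↥(Nf none) + ∑ i, Module.finrank k ↥(Nf (some i)) :=
        Fintype.sum_option _
    _ = hTt.1.zdim + Nat.card {i : ι // lieWeightSpace H T (charOfWeight eX (P.root i)) ≠ ⊥} := by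
        rw [h1, hfinT.2, Nat.card_eq_fintype_card, Fintype.card_subtype]
        simp only [hU, Finset.sum_boole, Nat.cast_id]

/-- **At most one of `𝔤_{±α}` meets `Lie(B)` for a closed solvable `B ≤ G`** (`G` connected
reductive over an algebraically closed field of characteristic `0`, `T` a maximal torus with root
datum `P`): otherwise the velocities `e = du_α`, `f = du_{-α}` of the `SL₂` of the root lie in
`Lie(B)` (the root spaces being lines, 8.1.2), so do `u_{±α}(x) = exp (x ·)` lie in `B`
(`IsRootHom.coe_apply_eq_exp`, `expHom_mem_of_mem_lieAlgebraGL`), and `φ_α(SL₂) ≤ B` would make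
`SL₂(k)` solvable (`false_of_sl2Hom_unipotents_mem`). This replaces, in characteristic `0`, the
positive system `R⁺(B)` of Springer 7.4.5 ("`B` picks out one root from each pair `±α`").
[cite: SpringerLAG1998, 7.4.5 and Cor. 8.1.3 (i)] -/
theorem IsRootDatumOf.not_lieWeightSpace_ne_bot_and_neg [IsAlgClosed k] [CharZero k]
    (hG : IsConnectedReductive G) (hT : IsMaximalTorusIn T G) (h : IsRootDatumOf G T P eX eY)
    {B : Subgroup (GL n k)} (hBG : B ≤ G) (hBa : IsAlgebraicSubgroup B) (hBs : IsSolvable ↥B)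
    (i : ι) :
    letI := P.indexNeg
    ¬ (lieWeightSpace B T (charOfWeight eX (P.root i)) ≠ ⊥ ∧
        lieWeightSpace B T (charOfWeight eX (P.root (-i))) ≠ ⊥) := by
  letI := P.indexNeg
  rintro ⟨hpos, hneg⟩
  have hGa : IsAlgebraicSubgroup G := hG.1.1
  have hTc : IsZConnected T := hT.2.1.1
  have h0 : lieWeightSpace G T 1 ≤ lieAlgebraGL T := lieWeightSpace_one_le_lieAlgebraGL_holds G T hG hT
  set α : ↥T →* kˣ := charOfWeight eX (P.root i) with hαdef
  have hαalg : IsAlgebraicChar α := (Additive.toMul (eX.symm (P.root i))).2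
  have hα1 : α ≠ 1 := by
    obtain ⟨β, hβ, hβi⟩ := h.exists_root_eq i
    rw [hαdef, ← hβi]; exact hβ.1
  have hα1' : α⁻¹ ≠ 1 := by
    intro h1; apply hα1
    refine MonoidHom.ext fun t => ?_
    have h2 := DFunLike.congr_fun h1 t
    rw [MonoidHom.inv_apply, MonoidHom.one_apply, inv_eq_one] at h2
    rw [h2, MonoidHom.one_apply]
  have hneg' : charOfWeight eX (P.root (-i)) = α⁻¹ := by
    rw [hαdef, ← charOfWeight_neg]
    congr 1
    change P.root (P.reflectionPerm i i) = -P.root i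
    rw [RootPairing.root_reflectionPerm, RootPairing.reflection_apply_self]
  have hdim : Module.finrank k ↥(lieWeightSpace G T α) ≤ 1 :=
    finrank_lieWeightSpace_le_one_of_lieWeightSpace_one_le hG hT h0 h i
  have hdim' : Module.finrank k ↥(lieWeightSpace G T α⁻¹) ≤ 1 := by
    have := finrank_lieWeightSpace_le_one_of_lieWeightSpace_one_le hG hT h0 h (-i)
    rwa [hneg'] at this
  rw [hneg'] at hneg
  -- the `SL₂` of the root and its two velocities
  obtain ⟨φ, -, hu, hu', -⟩ := h.exists_sl2Hom i
  have hu'α : IsRootHom G T h.le α⁻¹ (φ.comp unipotentLowerSL2) := hu'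
  have he : hu.1.velocity ∈ lieWeightSpace G T α := hu.velocity_mem_lieWeightSpace
  have hf : hu'α.1.velocity ∈ lieWeightSpace G T α⁻¹ := hu'α.velocity_mem_lieWeightSpace
  have hen : IsNilpotent hu.1.velocity := isNilpotent_of_mem_weightSpaceGL hTc hαalg hα1 he.2
  have hfn : IsNilpotent hu'α.1.velocity := isNilpotent_of_mem_weightSpaceGL hTc hαalg.inv hα1' hf.2
  have he0 : hu.1.velocity ≠ 0 := hu.1.velocity_ne_zero (ne_one_of_injective hu.injective)
  have hf0 : hu'α.1.velocity ≠ 0 := hu'α.1.velocity_ne_zero (ne_one_of_injective hu'α.injective)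
  -- both velocities lie in `Lie(B)`
  have hmemB : ∀ {χ : ↥T →* kˣ} {v : Matrix n n k}, Module.finrank k ↥(lieWeightSpace G T χ) ≤ 1 →
      v ∈ lieWeightSpace G T χ → lieWeightSpace B T χ ≠ ⊥ → v ∈ lieAlgebraGL B := by
    intro χ v hd hv hb
    obtain ⟨A, hA, hA0⟩ := (Submodule.ne_bot_iff _).1 hb
    have hAG : A ∈ lieWeightSpace G T χ := ⟨lieAlgebraGL_mono hBG hA.1, hA.2⟩
    obtain ⟨c, hc⟩ := exists_eq_smul_of_finrank_le_one hd hAG hA0 hv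
    rw [hc]
    exact Submodule.smul_mem _ c hA.1
  have heB : hu.1.velocity ∈ lieAlgebraGL B := hmemB hdim he hpos
  have hfB : hu'α.1.velocity ∈ lieAlgebraGL B := hmemB hdim' hf hneg
  refine false_of_sl2Hom_unipotents_mem hu.injective hBs (fun x => ?_) (fun x => ?_)
  · have hx := hu.coe_apply_eq_exp hGa hen (Multiplicative.toAdd x)
    rw [ofAdd_toAdd, MonoidHom.comp_apply] at hx
    rw [hx]
    exact expHom_mem_of_mem_lieAlgebraGL hBa heB hen _
  · have hx := hu'α.coe_apply_eq_exp hGa hfn (Multiplicative.toAdd x)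
    rw [ofAdd_toAdd, MonoidHom.comp_apply] at hx
    rw [hx]
    exact expHom_mem_of_mem_lieAlgebraGL hBa hfB hfn _

/-- Hence **`2 · #{α ∈ R | Lie(B)_α ≠ 0} ≤ |R|`** for a closed solvable `B ≤ G`: `α ↦ -α` maps the
roots whose root space meets `Lie(B)` into the others. [cite: SpringerLAG1998, Cor. 8.1.3 (ii)] -/
theorem IsRootDatumOf.two_mul_card_lieWeightSpace_ne_bot_le [IsAlgClosed k] [CharZero k]
    (hG : IsConnectedReductive G) (hT : IsMaximalTorusIn T G) (h : IsRootDatumOf G T P eX eY)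
    {B : Subgroup (GL n k)} (hBG : B ≤ G) (hBa : IsAlgebraicSubgroup B) (hBs : IsSolvable ↥B) :
    2 * Nat.card {i : ι // lieWeightSpace B T (charOfWeight eX (P.root i)) ≠ ⊥} ≤ Nat.card ι := by
  classical
  haveI : Finite ι := h.finite_index hG hT
  letI := P.indexNeg
  let p : ι → Prop := fun i => lieWeightSpace B T (charOfWeight eX (P.root i)) ≠ ⊥
  have hmap : ∀ i, p i → ¬ p (-i) := fun i hi hni =>
    h.not_lieWeightSpace_ne_bot_and_neg hG hT hBG hBa hBs i ⟨hi, hni⟩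
  let f : {i // p i} → {i // ¬ p i} := fun x => ⟨-x.1, hmap x.1 x.2⟩
  have hf : Function.Injective f := fun x x' hxx' =>
    Subtype.ext (neg_injective (congrArg Subtype.val hxx'))
  have hle : Nat.card {i // p i} ≤ Nat.card {i // ¬ p i} := Nat.card_le_card_of_injective f hf
  have hsum : Nat.card ι = Nat.card {i // p i} + Nat.card {i // ¬ p i} := by
    rw [← Nat.card_sum, Nat.card_congr (Equiv.sumCompl p)]
  change 2 * Nat.card {i // p i} ≤ Nat.card ι
  omega

/-- **Springer 8.1.3 (ii), first formula: `dim B = dim T + ½|R|` for every Borel subgroup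
`B ⊇ T`**, over an algebraically closed field of characteristic `0`, granted a root datum `P` of
`(G, T)` (roots indexed by `ι`; doubled to stay in `ℕ`). Upper bound: `dim B = dim Lie(B)` (4.4.6)
`= dim T + #{α | Lie(B)_α ≠ 0} ≤ dim T + ½|R|` (`finrank_lieAlgebraGL_eq`,
`two_mul_card_lieWeightSpace_ne_bot_le`). Lower bound: for a regular coweight `y` the closed
connected solvable `H(y) = ⟨T, U_α : ⟨α, y⟩ > 0⟩` lies in a Borel subgroup `B₁` (6.2), and
`dim B₁ ≥ dim H(y) ≥ dim T + #{α | ⟨α, y⟩ > 0} = dim T + ½|R|` (the velocities `du_α` lie in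
`Lie(H(y))`); finally all Borel subgroups are conjugate (6.2.7 (iii), `isBorelIn_conj_holds`) of
equal dimension. [cite: SpringerLAG1998, Cor. 8.1.3 (ii)] -/
theorem IsRootDatumOf.two_mul_zdim_borel [IsAlgClosed k] [CharZero k]
    (hG : IsConnectedReductive G) (hT : IsMaximalTorusIn T G) (h : IsRootDatumOf G T P eX eY)
    {B : Subgroup (GL n k)} (hB : IsBorelIn B G) (hTB : T ≤ B) :
    2 * hB.2.1.zdim = 2 * hT.2.1.1.zdim + Nat.card ι := by
  classical
  haveI : Finite ι := h.finite_index hG hT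
  have hTt : IsTorusSubgroup T := hT.2.1
  have hTc : IsZConnected T := hTt.1
  -- upper bound for every Borel subgroup containing `T`
  have hupper : ∀ {B' : Subgroup (GL n k)} (hB' : IsBorelIn B' G), T ≤ B' →
      2 * hB'.2.1.zdim ≤ 2 * hT.2.1.1.zdim + Nat.card ι := by
    intro B' hB' hTB'
    have hfin := hB'.2.1.finrank_lieAlgebraGL_eq
    have hcount := h.finrank_lieAlgebraGL_eq hG hT hTB' hB'.1
    have hhalf := h.two_mul_card_lieWeightSpace_ne_bot_le hG hT hB'.1 hB'.2.1.1 hB'.2.2.1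
    rw [← hfin.2, hcount]
    omega
  -- a regular coweight and the connected solvable group `H(y) = ⟨T, U_α : ⟨α, y⟩ > 0⟩`
  obtain ⟨y, hy⟩ := P.exists_forall_root'_ne_zero
  set H : Subgroup (GL n k) :=
    T ⊔ ⨆ (i : ι) (_ : 0 < P.root' i y), rootSubgroup G T (charOfWeight eX (P.root i)) with hHdef
  have hTH : T ≤ H := le_sup_left
  have hHG : H ≤ G := sup_le hT.1 (iSup₂_le fun i _ => rootSubgroup_le G T _)
  have hHc : IsZConnected H :=
    isZConnected_sup hTc (isZConnected_iSup _ fun i => isZConnected_iSup_prop fun _ =>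
      isZConnected_rootSubgroup (G := G) (T := T) _)
  have hHs : IsSolvable ↥H := isSolvable_sup_iSup_rootSubgroup_of_coweight hTt.2.2 P y eX
  obtain ⟨B₁, hB₁, hHB₁⟩ := exists_isBorelIn_ge hHG hHc hHs
  have hTB₁ : T ≤ B₁ := hTH.trans hHB₁
  -- lower bound: `dim B₁ ≥ dim H(y) ≥ dim T + ½|ι|`
  have hlow : 2 * hT.2.1.1.zdim + Nat.card ι ≤ 2 * hB₁.2.1.zdim := by
    have h1 : hHc.zdim ≤ hB₁.2.1.zdim := hHc.zdim_le_of_le hB₁.2.1 hHB₁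
    have hfinH := hHc.finrank_lieAlgebraGL_eq
    have hcount := h.finrank_lieAlgebraGL_eq hG hT hTH hHG
    have hmem : ∀ x : {i : ι // 0 < P.root' i y},
        lieWeightSpace H T (charOfWeight eX (P.root x.1)) ≠ ⊥ := by
      intro x
      obtain ⟨φ, -, hu, -, -⟩ := h.exists_sl2Hom x.1
      have hle : (φ.comp unipotentUpperSL2).range.map G.subtype ≤ H := by
        refine le_trans ?_ (le_sup_of_le_right (le_iSup₂_of_le x.1 x.2 le_rfl))
        unfold rootSubgroup
        exact le_iSup_of_le h.le (le_iSup₂_of_le (φ.comp unipotentUpperSL2) hu le_rfl)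
      have hv : hu.1.velocity ∈ lieWeightSpace H T (charOfWeight eX (P.root x.1)) :=
        ⟨hu.1.velocity_mem_lieAlgebraGL hle, hu.velocity_mem_weightSpaceGL⟩
      have hv0 : hu.1.velocity ≠ 0 := hu.1.velocity_ne_zero (ne_one_of_injective hu.injective)
      exact fun hb => hv0 ((Submodule.eq_bot_iff _).1 hb _ hv)
    have hpos : Nat.card {i : ι // 0 < P.root' i y} ≤
        Nat.card {i : ι // lieWeightSpace H T (charOfWeight eX (P.root i)) ≠ ⊥} :=
      Nat.card_le_card_of_injective
        (fun x => (⟨x.1, hmem x⟩ : {i : ι // lieWeightSpace H T (charOfWeight eX (P.root i)) ≠ ⊥}))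
        fun x x' hx => Subtype.ext (by simpa using congrArg Subtype.val hx)
    have hreg : 2 * Nat.card {i : ι // 0 < P.root' i y} = Nat.card ι :=
      P.two_mul_card_root'_pos hy
    rw [← hfinH.2] at h1
    omega
  -- conjugacy of Borel subgroups: `dim B = dim B₁`
  obtain ⟨g, -, hBg⟩ := isBorelIn_conj_holds hG.1 hB₁ hB
  have hdimeq : hB.2.1.zdim = hB₁.2.1.zdim := by
    subst hBg
    exact hB₁.2.1.zdim_map_conj g
  have hu₁ := hupper hB₁ hTB₁
  omega

/-- **Springer 8.1.3 (ii) in characteristic `0`, from a root datum of `(G, T)`**: for `G`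
connected reductive over an algebraically closed field of characteristic `0`, `T` a maximal torus
admitting a root datum (`IsRootDatumOf`, 7.4.3) and `B ⊇ T` a Borel subgroup,
`2 dim B = 2 dim T + |R|` (`two_mul_zdim_borel`) and `dim G = dim T + |R|`
(`zdim_eq_rank_add_card_roots_of_lieWeightSpace_one_le`, `RootSpaceLine.lean`), `R = roots G T`
(`card_roots_eq`). [cite: SpringerLAG1998, Cor. 8.1.3 (ii)] -/
theorem IsRootDatumOf.zdim_borel_and_group [IsAlgClosed k] [CharZero k]
    (hG : IsConnectedReductive G) (hT : IsMaximalTorusIn T G) (h : IsRootDatumOf G T P eX eY)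
    {B : Subgroup (GL n k)} (hB : IsBorelIn B G) (hTB : T ≤ B) :
    2 * hB.2.1.zdim = 2 * hT.2.1.1.zdim + Nat.card ↥(roots G T) ∧
      hG.1.zdim = hT.2.1.1.zdim + Nat.card ↥(roots G T) := by
  rw [h.card_roots_eq]
  exact ⟨h.two_mul_zdim_borel hG hT hB hTB,
    zdim_eq_rank_add_card_roots_of_lieWeightSpace_one_le
      (lieWeightSpace_one_le_lieAlgebraGL_holds G T) hG hT h⟩

end Count

/-! ### The named fact in characteristic `0`, from the existence of the root datum (7.4.3) -/

/-- **`zdim_borel_and_group` (Springer 8.1.3 (ii)) holds in characteristic `0` granted the root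
datum of `(G, T)`** (`exists_isRootDatumOf`, Springer 7.4.3; lang.S13 (b)): both dimension
formulas `2 dim B = 2 dim T + |R|`, `dim G = dim T + |R|` for every Borel subgroup `B ⊇ T`
(`IsRootDatumOf.zdim_borel_and_group`). Positive characteristic remains open here (it needs
8.1.2 and 7.4.5 of the structure theory, the named facts `lieWeights_eq_roots`,
`isBorelIn_centralizer_inf_of_isBorelIn`, `exists_rootHom_sup_isBorelIn_of_central`).
[cite: SpringerLAG1998, Cor. 8.1.3 (ii) with 7.4.3] -/
theorem zdim_borel_and_group_of_exists_isRootDatumOf [CharZero k] {G T : Subgroup (GL n k)}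
    (hex : exists_isRootDatumOf (G := G) (T := T)) :
    zdim_borel_and_group (G := G) (T := T) := by
  intro _ hG hT B hB hTB
  haveI : IsMulCommutative ↥T := hT.2.1.2.1
  obtain ⟨ι, X, Y, _, _, _, P, eX, eY, h, -⟩ := hex hG hT
  exact h.zdim_borel_and_group hG hT hB hTB

/-- **`zdim_borel_and_group` (Springer 8.1.3 (ii)) in characteristic `0` from three leaves of the
structure theory**: `Z_G(S)` connected reductive for subtori `S` (7.6.4 (i),
`isConnectedReductive_centralizer_torus`), `Z_G(T) = T` (7.6.4 (ii),
`centralizer_eq_of_isMaximalTorusIn`) and the Borel subgroups `T · U_α` in semisimple rank one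
(7.3.3 (ii), `exists_rootHom_sup_isBorelIn_of_central`) — through the existence of the root datum
(`exists_isRootDatumOf_of_structureFacts`, `RankOneAssembly.lean`, with 6.2.7 (ii) discharged by
`isClosed_orbitCone_of_borel_le_lineStabilizer_holds`).
[cite: SpringerLAG1998, Cor. 8.1.3 (ii) with 7.4.3, 7.6.4, 7.3.3 (ii)] -/
theorem zdim_borel_and_group_of_structureFacts [CharZero k] {G T : Subgroup (GL n k)}
    (hA : isConnectedReductive_centralizer_torus (k := k) (n := n))
    (hF₃ : centralizer_eq_of_isMaximalTorusIn (k := k) (n := n))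
    (hC₂ : exists_rootHom_sup_isBorelIn_of_central (k := k) (n := n)) :
    zdim_borel_and_group (G := G) (T := T) :=
  zdim_borel_and_group_of_exists_isRootDatumOf
    (exists_isRootDatumOf_of_structureFacts hA hF₃ hC₂
      isClosed_orbitCone_of_borel_le_lineStabilizer_holds)

end Literature.NumberTheory.Automorphic
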